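import Literature.Geometry.Lorentzian.TameGenericityLocalWindow
import Literature.Geometry.Lorentzian.DataFamilyTangentKernelManifold
import HarnessLib

/-!
# Route `ExactKerrEnds`, crux `CensorshipAlongKerrEnds` (stmt-FinalStateConjecture-18521), line `Sketch`:
# stub `stub_windowUpgrade` — WINDOW UPGRADE

Let `F : ℝ¹ → InitialDataSet (𝓡 3) X` be a one-parameter family of initial data sets which is tame on
the end `e` (`InitialDataSet.IsTameDataFamily`: jointly smooth, sole end, Dafermos–Rodnianski flat
members with continuous mass, `wDist`-continuous at `0`) and immersed at `0`
(`InitialDataSet.IsImmersedAtZero`), and whose members with `0 < ‖c‖ < ε` satisfy a property `P`.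
Then there is a tame, INJECTIVE, immersed family `F'` on the same end with `F' 0 = F 0` all of whose
members off `0` satisfy `P`.

Proof. The library lemma `InitialDataSet.exists_tameFamily_of_localWindow`
(`Literature/Geometry/Lorentzian/TameGenericityLocalWindow.lean`, radial contraction of the
parameter line into a window) does everything once the family is injective ON A WINDOW
`‖c‖ < δ`. Window injectivity follows from immersion at `0` and joint smoothness: immersion applied
to the basis vector `e₀ ≠ 0` of `ℝ¹` yields a point `x`, tangent vectors `u, w` at `x` and a scalar
component `g c := h_{F c}(x)(u, w)` or `g c := k_{F c}(x)(u, w)` with `dg(0) e₀ ≠ 0`; `g` is smooth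
(the section `c ↦ (x, h_{F c}(x))` of the bundle of bilinear forms read in the trivialisation of
`TX` at `x`, `contMDiffAt_bilin_iff`, `contMDiff_iff_contDiff`, evaluated at constant trivialised
vectors); a `C¹` function with non-zero derivative at `0` along `e₀` is strictly monotone, hence
injective, on `{t e₀ : |t| < δ}` (`strictMonoOn_of_deriv_pos` / `strictAntiOn_of_deriv_neg` on an
interval where the continuous derivative keeps its sign); and on `ℝ¹`, `c = c₀ e₀` with
`‖c‖ = |c₀|`, so `F c = F c'` with `‖c‖, ‖c'‖ < δ` forces `g c = g c'`, `c₀ = c'₀`, `c = c'`. The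
window of the library lemma is `min ε δ` and its admissible class is `Set.univ`.

The helper lemmas are private copies adapted from the accepted
`Theorems/EIHFluxBalanceModulatedKerrHandoffStubInjOnOfImmersed.lean` (stub `stub_injOn_of_immersed`)
and `Theorems/RobustClausewiseGenericityAssembly.lean` (`exists_injOn_line_of_fderiv_ne`), kept local
to spare this file those modules' import closure. Mathlib + the Literature cone only; no
definitions, no named facts. Christodoulou, CQG 16 (1999) A23, p. A24 (independent directions of a
family, the fixed space `𝓐`); Lee, *Introduction to Smooth Manifolds* (2013), Prop. 4.1
(immersions are locally injective). Stub-worker of the line lead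
prover-line-stmt-FinalStateConjecture-18521-0, 2026-08-17; the statement is shared verbatim with
line `base-point-reduction` (its Stub 1).
-/

-- the summit-side namespace `Summit.FinalStateConjecture.FinalStateConjecture.…` (summit = problem)
-- doubles the `FinalStateConjecture` path component by design; `dupNamespace` would flag every decl.
set_option linter.dupNamespace false

noncomputable section

open scoped Manifold ContDiff Topology
open Bundle Filter Set Function TopologicalSpace Literature.Geometry.Lorentzian InitialDataSet

namespace Summit.FinalStateConjecture.FinalStateConjecture.Theorems.ExactKerrEnds.CensorshipAlongKerrEnds

/-! ## One-dimensional calculus: non-zero derivative along a direction ⇒ injective on a window -/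

section Analysis

variable {E : Type*} [NormedAddCommGroup E] [NormedSpace ℝ E]

-- adapted from `RobustClausewiseGenericity.exists_injOn_line_of_fderiv_ne`
-- (`Theorems/RobustClausewiseGenericityAssembly.lean`)
/-- Along a direction `u` with `df(0) u ≠ 0`, a `C¹` function `f : E → ℝ` is injective on the
segment `{t u : |t| < δ}` for some `δ > 0`: the derivative of `t ↦ f (t u)` is continuous and
non-zero at `0`, so it keeps its sign on an interval `(-δ, δ)`, where `t ↦ f (t u)` is then strictly
monotone (`strictMonoOn_of_deriv_pos` / `strictAntiOn_of_deriv_neg`). [folklore] -/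
private theorem exists_injOn_line_of_fderiv_ne {f : E → ℝ} (hf : ContDiff ℝ 1 f) {u : E}
    (hu : fderiv ℝ f 0 u ≠ 0) :
    ∃ δ : ℝ, 0 < δ ∧ ∀ t t' : ℝ, |t| < δ → |t'| < δ → f (t • u) = f (t' • u) → t = t' := by
  set g : ℝ → ℝ := fun t ↦ f (t • u) with hg_def
  have hline : ContDiff ℝ 1 (fun t : ℝ ↦ t • u) := contDiff_id.smul contDiff_const
  have hg : ContDiff ℝ 1 g := hf.comp hline
  have hderiv : ∀ t : ℝ, HasDerivAt g (fderiv ℝ f (t • u) u) t := by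
    intro t
    have h1 : HasDerivAt (fun s : ℝ ↦ s • u) ((1 : ℝ) • u) t := (hasDerivAt_id t).smul_const u
    rw [one_smul] at h1
    exact ((hf.differentiable one_ne_zero) (t • u)).hasFDerivAt.comp_hasDerivAt t h1
  have hcont : Continuous (deriv g) := hg.continuous_deriv le_rfl
  have hd0 : deriv g 0 = fderiv ℝ f 0 u := by
    rw [(hderiv 0).deriv, zero_smul]
  have hne : deriv g 0 ≠ 0 := by rwa [hd0]
  rcases lt_or_gt_of_ne hne with hneg | hpos
  · obtain ⟨δ, hδ, hball⟩ := Metric.eventually_nhds_iff.1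
      (hcont.continuousAt.eventually (gt_mem_nhds hneg))
    refine ⟨δ, hδ, fun t t' ht ht' hEq ↦ ?_⟩
    have hanti : StrictAntiOn g (Ioo (-δ) δ) := by
      refine strictAntiOn_of_deriv_neg (convex_Ioo _ _) hg.continuous.continuousOn ?_
      intro x hx
      rw [interior_Ioo] at hx
      exact hball (by simpa [Real.dist_eq, abs_lt] using hx)
    exact hanti.injOn (by simpa [abs_lt] using ht) (by simpa [abs_lt] using ht') hEq
  · obtain ⟨δ, hδ, hball⟩ := Metric.eventually_nhds_iff.1
      (hcont.continuousAt.eventually (lt_mem_nhds hpos))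
    refine ⟨δ, hδ, fun t t' ht ht' hEq ↦ ?_⟩
    have hmono : StrictMonoOn g (Ioo (-δ) δ) := by
      refine strictMonoOn_of_deriv_pos (convex_Ioo _ _) hg.continuous.continuousOn ?_
      intro x hx
      rw [interior_Ioo] at hx
      exact hball (by simpa [Real.dist_eq, abs_lt] using hx)
    exact hmono.injOn (by simpa [abs_lt] using ht) (by simpa [abs_lt] using ht') hEq

/-- **Window injectivity from one smooth scalar invariant.** If `g : ℝ¹ → ℝ` is smooth with
`dg(0) e₀ ≠ 0` and `g` factors through `F : ℝ¹ → α` (`F c = F c' → g c = g c'`), then `F` is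
injective on a window `‖c‖ < δ`: `t ↦ g (t e₀)` is injective for `|t| < δ`
(`exists_injOn_line_of_fderiv_ne`), and on `ℝ¹` one has `c = c₀ e₀` and `‖c‖ = |c₀|`. [folklore] -/
private theorem exists_window_injOn_of_scalar {α : Type*} (F : EuclideanSpace ℝ (Fin 1) → α)
    {g : EuclideanSpace ℝ (Fin 1) → ℝ} (hg : ContDiff ℝ ∞ g)
    (hg0 : fderiv ℝ g 0 (EuclideanSpace.single (0 : Fin 1) (1 : ℝ)) ≠ 0)
    (hFg : ∀ c c', F c = F c' → g c = g c') :
    ∃ δ > (0 : ℝ), ∀ c c', ‖c‖ < δ → ‖c'‖ < δ → F c = F c' → c = c' := by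
  -- adapted from `exists_window_injOn_of_scalar` of
  -- `Theorems/EIHFluxBalanceModulatedKerrHandoffStubInjOnOfImmersed.lean`
  have hg1 : ContDiff ℝ 1 g := hg.of_le (by exact_mod_cast le_top)
  obtain ⟨δ, hδ, hinj⟩ := exists_injOn_line_of_fderiv_ne hg1 hg0
  refine ⟨δ, hδ, fun c c' hc hc' hEq ↦ ?_⟩
  -- on `ℝ¹`: `c = c₀ e₀` and `‖c‖ = |c₀|`
  have hce : ∀ c : EuclideanSpace ℝ (Fin 1),
      c 0 • EuclideanSpace.single (0 : Fin 1) (1 : ℝ) = c := fun c ↦ by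
    ext i
    fin_cases i
    simp
  have hcn : ∀ c : EuclideanSpace ℝ (Fin 1), ‖c‖ = |c 0| := fun c ↦ by
    rw [EuclideanSpace.norm_eq, Fin.sum_univ_one, Real.norm_eq_abs, sq_abs, Real.sqrt_sq_eq_abs]
  have hgc : g (c 0 • EuclideanSpace.single (0 : Fin 1) (1 : ℝ)) =
      g (c' 0 • EuclideanSpace.single (0 : Fin 1) (1 : ℝ)) := by
    rw [hce c, hce c']
    exact hFg c c' hEq
  have h00 : c 0 = c' 0 :=
    hinj (c 0) (c' 0) (by rw [← hcn]; exact hc) (by rw [← hcn]; exact hc') hgc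
  rw [← hce c, ← hce c', h00]

end Analysis

/-! ## Scalar components of a jointly smooth family are smooth in the parameter -/

section Components

variable {X : Type} [TopologicalSpace X] [ChartedSpace E3 X] [IsManifold (𝓡 3) ∞ X]

-- adapted from `contDiff_bilin_apply_of_contMDiff_family` of
-- `Theorems/EIHFluxBalanceModulatedKerrHandoffStubInjOnOfImmersed.lean`
/-- A scalar component `c ↦ s_c(v₀, w₀)` of a smooth family `c ↦ (x₀, s_c)` of bilinear forms on the
FIXED tangent space `T_{x₀} X` (a smooth map `ℝᵐ →` the bundle of bilinear forms on `TX` over the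
constant base point `x₀`) is a smooth function of the parameter: read the section in the
trivialisation of `TX` at `x₀` (`contMDiffAt_bilin_iff`, `contMDiff_iff_contDiff`) and evaluate at
the (constant) trivialised vectors. [folklore] -/
private theorem contDiff_bilin_apply_of_contMDiff_family {m : ℕ} (x₀ : X)
    {s : EuclideanSpace ℝ (Fin m) → (TangentSpace (𝓡 3) x₀ →L[ℝ] TangentSpace (𝓡 3) x₀ →L[ℝ] ℝ)}
    (hs : ContMDiff 𝓘(ℝ, EuclideanSpace ℝ (Fin m)) ((𝓡 3).prod 𝓘(ℝ, E3 →L[ℝ] E3 →L[ℝ] ℝ)) ∞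
      (fun c : EuclideanSpace ℝ (Fin m) ↦ TotalSpace.mk' (E3 →L[ℝ] E3 →L[ℝ] ℝ)
        (E := fun x : X ↦ TangentSpace (𝓡 3) x →L[ℝ] TangentSpace (𝓡 3) x →L[ℝ] ℝ) x₀ (s c)))
    (v₀ w₀ : TangentSpace (𝓡 3) x₀) :
    ContDiff ℝ ∞ (fun c : EuclideanSpace ℝ (Fin m) ↦ s c v₀ w₀) := by
  set T := trivializationAt E3 (TangentSpace (𝓡 3) : X → Type _) x₀ with hT
  have h2 : ContMDiff 𝓘(ℝ, EuclideanSpace ℝ (Fin m)) 𝓘(ℝ, E3 →L[ℝ] E3 →L[ℝ] ℝ) ∞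
      (fun c : EuclideanSpace ℝ (Fin m) ↦ (ContinuousLinearMap.precomp ℝ (T.symmL ℝ x₀)).comp
        ((s c).comp (T.symmL ℝ x₀))) := fun c ↦
    ((contMDiffAt_bilin_iff (IX := 𝓘(ℝ, EuclideanSpace ℝ (Fin m))) (IB := 𝓡 3)
      (V := (TangentSpace (𝓡 3) : X → Type _)) (b := fun _ : EuclideanSpace ℝ (Fin m) ↦ x₀)
      (s := s) (x₀ := c)).1 (hs c)).2
  have h3 : ContDiff ℝ ∞ (fun c : EuclideanSpace ℝ (Fin m) ↦
      (ContinuousLinearMap.precomp ℝ (T.symmL ℝ x₀)).comp ((s c).comp (T.symmL ℝ x₀))) :=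
    contMDiff_iff_contDiff.1 h2
  have hx₀T : x₀ ∈ T.baseSet := FiberBundle.mem_baseSet_trivializationAt' x₀
  set u : E3 := T.continuousLinearMapAt ℝ x₀ v₀ with hu
  set u' : E3 := T.continuousLinearMapAt ℝ x₀ w₀ with hu'
  have hsu : T.symmL ℝ x₀ u = v₀ := T.symmL_continuousLinearMapAt hx₀T v₀
  have hsu' : T.symmL ℝ x₀ u' = w₀ := T.symmL_continuousLinearMapAt hx₀T w₀
  have h4 : (fun c : EuclideanSpace ℝ (Fin m) ↦ s c v₀ w₀) =
      fun c ↦ ((ContinuousLinearMap.precomp ℝ (T.symmL ℝ x₀)).comp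
        ((s c).comp (T.symmL ℝ x₀))) u u' := by
    funext c
    simp only [ContinuousLinearMap.coe_comp, Function.comp_apply,
      ContinuousLinearMap.precomp_apply, hsu, hsu']
  rw [h4]
  exact (h3.clm_apply contDiff_const).clm_apply contDiff_const

/-- The metric component `c ↦ h_{F c}(x₀)(v₀, w₀)` of a jointly smooth family of data, at a fixed
point and fixed tangent vectors, is a smooth function of the parameter (the first component of
`IsSmoothDataFamily` restricted to the slice `c ↦ (c, x₀)`). [folklore] -/
private theorem contDiff_h_inner_apply_family {m : ℕ}
    {F : EuclideanSpace ℝ (Fin m) → InitialDataSet (𝓡 3) X} (hF : IsSmoothDataFamily m F)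
    (x₀ : X) (v₀ w₀ : TangentSpace (𝓡 3) x₀) :
    ContDiff ℝ ∞ (fun c : EuclideanSpace ℝ (Fin m) ↦ (F c).h.inner x₀ v₀ w₀) :=
  contDiff_bilin_apply_of_contMDiff_family x₀ (s := fun c ↦ (F c).h.inner x₀)
    (hF.1.comp (contMDiff_id.prodMk contMDiff_const)) v₀ w₀

/-- The extrinsic-curvature component `c ↦ k_{F c}(x₀)(v₀, w₀)` of a jointly smooth family of
data, at a fixed point and fixed tangent vectors, is a smooth function of the parameter (the second
component of `IsSmoothDataFamily` restricted to the slice `c ↦ (c, x₀)`). [folklore] -/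
private theorem contDiff_k_apply_family {m : ℕ}
    {F : EuclideanSpace ℝ (Fin m) → InitialDataSet (𝓡 3) X} (hF : IsSmoothDataFamily m F)
    (x₀ : X) (v₀ w₀ : TangentSpace (𝓡 3) x₀) :
    ContDiff ℝ ∞ (fun c : EuclideanSpace ℝ (Fin m) ↦ (F c).k x₀ v₀ w₀) :=
  contDiff_bilin_apply_of_contMDiff_family x₀ (s := fun c ↦ (F c).k x₀)
    (hF.2.comp (contMDiff_id.prodMk contMDiff_const)) v₀ w₀

/-- **A jointly smooth curve immersed at `0` is injective on a window.** If `F : ℝ¹ → data` is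
jointly smooth (`IsSmoothDataFamily`) and immersed at `0` (`IsImmersedAtZero`), then applying
immersion to `e₀ ≠ 0` yields a scalar component `g c = h_{F c}(x)(u, w)` or `g c = k_{F c}(x)(u, w)`
with `dg(0) e₀ ≠ 0`; `g` is smooth (`contDiff_h_inner_apply_family` / `contDiff_k_apply_family`),
and `exists_window_injOn_of_scalar` gives the window. Christodoulou, CQG 16 (1999), p. A24; Lee
2013, Prop. 4.1. [folklore] -/
private theorem exists_window_injOn_of_immersed {F : EuclideanSpace ℝ (Fin 1) → InitialDataSet (𝓡 3) X}
    (hF : IsSmoothDataFamily 1 F) (hI : IsImmersedAtZero 1 F) :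
    ∃ δ > (0 : ℝ), ∀ c c', ‖c‖ < δ → ‖c'‖ < δ → F c = F c' → c = c' := by
  -- the basis vector of `ℝ¹` is non-zero; immersion there gives the witnessing component
  have he₀ : (EuclideanSpace.single (0 : Fin 1) (1 : ℝ) : EuclideanSpace ℝ (Fin 1)) ≠ 0 := by
    rw [← norm_ne_zero_iff, PiLp.norm_single, norm_one]
    exact one_ne_zero
  obtain ⟨x, u, w, huw⟩ := hI _ he₀
  rcases huw with h | h
  · exact exists_window_injOn_of_scalar F (contDiff_h_inner_apply_family hF x u w) h
      (fun c c' hcc' ↦ by rw [hcc'])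
  · exact exists_window_injOn_of_scalar F (contDiff_k_apply_family hF x u w) h
      (fun c c' hcc' ↦ by rw [hcc'])

end Components

/-! ## The stub -/

/-- **Stub `stub_windowUpgrade` — WINDOW UPGRADE** (registered stub of the line `Sketch` of the crux
`CensorshipAlongKerrEnds`, stmt-FinalStateConjecture-18521; shared verbatim with line
`base-point-reduction`). A one-parameter family `F` of initial data sets, tame on the end `e` and
immersed at `0`, whose members with `0 < ‖c‖ < ε` satisfy `P`, is replaced by a tame, injective,
immersed family `F'` on the same end with `F' 0 = F 0` all of whose members off `0` satisfy `P`: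
`F` is injective on a window `‖c‖ < δ` (`exists_window_injOn_of_immersed`, from immersion and joint
smoothness), and `InitialDataSet.exists_tameFamily_of_localWindow` (radial contraction of `ℝ¹` into
the window `min ε δ`, admissible class `Set.univ`) does the rest. Christodoulou, CQG 16 (1999) A23,
p. A24. [cite: Christodoulou1999, p. A24] -/
theorem stub_windowUpgrade : ∀ (X : Type) [TopologicalSpace X] [ChartedSpace Literature.Geometry.Lorentzian.E3 X] [IsManifold (𝓡 3) ((⊤ : ℕ∞) : WithTop ℕ∞) X] [T2Space X] [SecondCountableTopology X] [ConnectedSpace X], ∀ (P : Literature.Geometry.Lorentzian.InitialDataSet (𝓡 3) X → Prop) (e : Literature.Geometry.Lorentzian.AFEnd X) (F : EuclideanSpace ℝ (Fin 1) → Literature.Geometry.Lorentzian.InitialDataSet (𝓡 3) X), Literature.Geometry.Lorentzian.InitialDataSet.IsTameDataFamily e 1 F → Literature.Geometry.Lorentzian.InitialDataSet.IsImmersedAtZero 1 F → (∃ ε > (0 : ℝ), ∀ c, c ≠ 0 → ‖c‖ < ε → P (F c)) → ∃ F' : EuclideanSpace ℝ (Fin 1) → Literature.Geometry.Lorentzian.InitialDataSet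 (𝓡 3) X, Literature.Geometry.Lorentzian.InitialDataSet.IsTameDataFamily e 1 F' ∧ F' 0 = F 0 ∧ Function.Injective F' ∧ Literature.Geometry.Lorentzian.InitialDataSet.IsImmersedAtZero 1 F' ∧ ∀ c ≠ 0, P (F' c) := by
  intro X _ _ _ _ _ _ P e F hF himm hPε
  obtain ⟨ε, hε, hP⟩ := hPε
  -- window injectivity from immersion at `0` and joint smoothness
  obtain ⟨δ, hδ, hinj⟩ := exists_window_injOn_of_immersed hF.1 himm
  -- the library reparametrisation on the window `min ε δ`, admissible class `univ`
  obtain ⟨F', hF', h0, hinj', himm', -, hP'⟩ :=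
    exists_tameFamily_of_localWindow (𝓓 := Set.univ) (P := P) hF himm (lt_min hε hδ)
      (fun c c' hc hc' h ↦ hinj c c' (hc.trans_le (min_le_right _ _))
        (hc'.trans_le (min_le_right _ _)) h)
      (fun _ _ ↦ Set.mem_univ _)
      (fun c hc hcε ↦ hP c hc (hcε.trans_le (min_le_left _ _)))
  exact ⟨F', hF', h0, hinj', himm', hP'⟩

end Summit.FinalStateConjecture.FinalStateConjecture.Theorems.ExactKerrEnds.CensorshipAlongKerrEnds

end
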